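import Literature.ModelTheory.ExponentialFields.Wilkie1989Lemma3Proofs
import HarnessLib

/-!
# Wilkie 1989, Lemma 2 (proved): good systems of maximal size inside a subring of finite height

Trunk `TranscendEllArithS`, family `periods` (periods.S28): towards the leaf
`Literature.ModelTheory.ExponentialFields.Wilkie1989_expAlgebraicPoints_mem` (`Wilkie1989.lean`;
§§5–6 of A. J. Wilkie, *On the theory of the real exponential field*, Illinois J. Math. 33
(1989), 384–408) of the decomposition of the named fact
`Literature.ModelTheory.ExponentialFields.wilkie_isModelComplete`.

Wilkie 1989, **Lemma 2** (p. 395).  "We call a subring `M` of `k[x̄]ᵉ` of *height* `0` if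
`M = k[x̄]`, and of height `≤ j + 1` if `M = M'[e^g]` for some `g ∈ M'`, where `M'` has height
`≤ j`. An element `h` of `M` has degree `≤ s` (in `M`) if `h = Σᵢ₌₀ˢ aᵢ e^{ig}` for some
`a₀, …, aₛ ∈ M'`.  LEMMA 2. Let `j, n ∈ ℕ`, `n ≥ 1` and suppose `ᾱ ∈ Kⁿ`. Let `M` have height
`≤ j` and suppose `p` is maximal such that for some `g₁, …, gₚ ∈ M`, `ᾱ ∈ Vⁿˢ(g₁, …, gₚ)`. If `j ≥ 1`,
suppose that `g₁, …, gₚ` all have degree `≤ s`. Then there are `h₁, …, hₚ ∈ M` such that: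
(1) If `j ≥ 1` then `h₁, …, hₚ₋₁` have degree `≤ 0` in `M` and `hₚ` has degree `≤ s` (in `M`).
(2) `ᾱ ∈ Vⁿˢ(h₁, …, hₚ)`. (3) If `h ∈ M`, `p < n` and `h(ᾱ) = 0`, then `h` vanishes on
`V(h₁, …, hₚ)` close to `ᾱ`.  *Proof.* By the proof of Lemma 1 (i.e., using the result of Lemma 1
with `M` in place of `k[x̄]ᵉ`) we can find `h₁, …, hₚ'` satisfying the first clause of (1), (2) and
(3) (where we are applying Lemma 1 with `S = {ᾱ}`). Now `p' ≤ p` … [and `p ≤ p'` by (3), §2 and the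
linear algebra (∗∗)]. Now recall that `hₚ'` was chosen (in the proof of Lemma 1) of minimal degree
such that `hₚ'(ᾱ) = 0` but such that `hₚ'` did not vanish on `V(h₁, …, hₚ'₋₁)` close to `ᾱ`. Thus,
if this degree is `> s`, a similar argument … again contradicts (∗∗)."

In the tree, the subrings of height `≤ j` are the stages `chain f n g (n + j)` of an admissible
chain `k = M₀ ⊆ k[x₁] ⊆ ⋯ ⊆ k[x̄] = Mₙ ⊆ Mₙ[e^{gₙ}] ⊆ ⋯` (`Wilkie1989Lemma3Proofs.lean`, "with
arbitrary exponents `gⱼ ∈ Mⱼ` these are the subrings of height `≤ j - n`"), degrees are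
`RealExpModel.DegLT`, and the proof of Lemma 1 is available step by step (`GoodSys`, `Clause3`,
`lemma1_step`, the minimal-degree datum `MinBad` of Case 2).  This file proves Lemma 2 in the
form in which §6 (pp. 403–407) uses it — including the information "from the proof" that §6
relies on (p. 407: "in the proof of Lemma 2 (or, rather, Lemma 1 with `S = {η̄}`) recall that `hₙ`
is chosen of minimal degree …"):

* `RealExpModel.exists_goodSys_max_le` and `RealExpModel.clause3_of_maximal_le`: the induction of
  Lemma 1 run only up to a given stage `J` (a good system for `S = {ᾱ}` with the maximal number
  of equations among the stages `≤ J` satisfies (3) at every stage up to `J`).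
* `RealExpModel.lemma2_cases` (**Lemma 2 with the proof information**): for `M = M_J[Y] = M_{J+1}`
  and a point `ᾱ`, there is a system `h₁, …, hₚ ∈ M_J` (degree `≤ 0`) with `ᾱ ∈ Vⁿˢ(h̄)` such that
  either `p = n`, or `p < n` and every element of `M` vanishing at `ᾱ` vanishes on `V(h̄)` close to
  `ᾱ` (clause (3)), or `p < n` and there is a minimal-degree datum `MinBad {ᾱ} J h̄ hₚ₊₁ ᾱ P s`
  (the function `hₚ₊₁ = P(Y) ∈ M` of exact degree `s ≥ 1` vanishing at `ᾱ` but not on `V(h̄)` close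
  to `ᾱ`, every element of degree `< s` vanishing at `ᾱ` vanishing on `V(h̄)` close to `ᾱ`), with
  `ᾱ ∈ Vⁿˢ(h̄, hₚ₊₁)` and clause (3) for the extended system at stage `J + 1`.
* The linear algebra "(∗∗)" behind "`p' ≤ p` … `p ≤ p'`" and "a similar argument … again
  contradicts (∗∗)": `RealExpModel.jrow_mem_span_of_vct` (§2: a function vanishing on `V(h̄)`
  close to `ᾱ` has its gradient in the span of the `∇hᵣ(ᾱ)`) and
  `RealExpModel.card_le_of_forall_jrow_mem_span` (independent gradients in that span number at
  most `p`), whence the **maximality** statements `RealExpModel.card_le_of_clause3` and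
  `RealExpModel.MinBad.card_le_of_degLT` (any system from `M`, resp. of degree `< s`, with `ᾱ` a
  non-singular zero has at most `p`, resp. `p`, members) — this is how §6 bounds degrees (p. 403:
  "`hₙ = Σᵢ₌₀^{s+1} aᵢ e^{ig}`") and recognizes the case `p = n - 1` (p. 406).

Everything here is proved; no named facts.

## References

* A. J. Wilkie, *On the theory of the real exponential field*, Illinois J. Math. 33 (1989),
  384–408: Lemma 2 and its proof (p. 395), proof of Lemma 1 (pp. 391–395), §6 (pp. 403, 406–407).
-/

noncomputable section

open FirstOrder FirstOrder.Language FirstOrder.Language.Structure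

namespace Literature.ModelTheory.ExponentialFields

namespace RealExpModel

variable {k K : Language.Theory.ModelType.{0, 0, 0} realExpTheory}
  {f : k ↪[Language.orderedExpRing] K} {n : ℕ}

/-! ### The linear algebra (∗∗) and §2: gradients in the span -/

section Span

variable {p : ℕ} {F : Fin p → termFnRing f n} {α : Fin n → K}

/-- **§2 at the point** (the use of "(by Section 2)" in the proof of Lemma 2, p. 395): if `G`
vanishes on `V(h₁, …, hₚ)` close to the non-singular zero `ᾱ`, then `∇G(ᾱ)` lies in the span of
`∇h₁(ᾱ), …, ∇hₚ(ᾱ)` (i.e. `(dh₁ ∧ ⋯ ∧ dhₚ ∧ dG)(ᾱ) = 0`). [cite: Wilkie1989, Lemma 2 (proof, p. 395)] -/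
theorem jrow_mem_span_of_vct (hα : α ∈ VnsF f n F) {G : termFnRing f n} (hG : VCT f n G F α) :
    jrow f n G α ∈ Submodule.span K (Set.range fun r => jrow f n (F r) α) := by
  have h := not_linearIndependent_snoc_of_vct hα.1 hG
  rw [linearIndependent_finSnoc, not_and] at h
  by_contra hne
  exact h hα.2 hne

/-- **The linear algebra (∗∗)** (p. 395: "Suppose `ω` is a `q`-form and `θ₁, …, θ_{q+1}` are
`1`-forms such that `(ω ∧ θᵢ)(ᾱ) = 0` for `i = 1, …, q + 1`. Then either `ω(ᾱ) = 0` or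
`(θ₁ ∧ ⋯ ∧ θ_{q+1})(ᾱ) = 0`"), in the form used: linearly independent vectors all lying in the span
of `p` vectors number at most `p`. [cite: Wilkie1989, Lemma 2 (proof, p. 395)] -/
theorem card_le_of_forall_mem_span {q : ℕ} {v : Fin p → Fin n → K} {w : Fin q → Fin n → K}
    (hw : LinearIndependent K w) (hmem : ∀ i, w i ∈ Submodule.span K (Set.range v)) : q ≤ p := by
  set W := Submodule.span K (Set.range v) with hW
  let w' : Fin q → W := fun i => ⟨w i, hmem i⟩
  have hw' : LinearIndependent K w' := by
    refine LinearIndependent.of_comp W.subtype ?_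
    exact hw
  have h1 := hw'.fintype_card_le_finrank
  have h2 : Module.finrank K W ≤ p := by
    have := finrank_range_le_card (R := K) v
    simpa [hW, Set.finrank] using this
  simpa using h1.trans h2

/-- Independent gradients of functions whose gradients lie in the span of `∇h₁(ᾱ), …, ∇hₚ(ᾱ)`
number at most `p`. [cite: Wilkie1989, Lemma 2 (proof, p. 395)] -/
theorem card_le_of_forall_jrow_mem_span {q : ℕ} {G : Fin q → termFnRing f n}
    (hG : LinearIndependent K fun i => jrow f n (G i) α)
    (hmem : ∀ i, jrow f n (G i) α ∈ Submodule.span K (Set.range fun r => jrow f n (F r) α)) :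
    q ≤ p :=
  card_le_of_forall_mem_span hG hmem

/-- **Maximality from clause (3)** ("`p ≤ p'`", p. 395): if every element of `M` vanishing at `ᾱ`
vanishes on `V(h₁, …, hₚ)` close to `ᾱ`, then no system of more than `p` elements of `M` has `ᾱ` as
a non-singular zero. [cite: Wilkie1989, Lemma 2 (proof, p. 395)] -/
theorem card_le_of_clause3 {g : ℕ → termFnRing f n} {j : ℕ} (hα : α ∈ VnsF f n F)
    (h3 : Clause3 {α} g j F) {q : ℕ} {G : Fin q → termFnRing f n}
    (hG : ∀ i, G i ∈ chain f n g j) (hαG : α ∈ VnsF f n G) : q ≤ p :=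
  card_le_of_forall_jrow_mem_span hαG.2 fun i =>
    jrow_mem_span_of_vct hα (h3 α rfl hα (G i) (hG i) (hαG.1 i))

/-- **Maximality below the minimal degree** ("if this degree is `> s`, a similar argument shows
that `(dh₁ ∧ ⋯ ∧ dhₚ'₋₁ ∧ dgᵢ)(ᾱ) = 0` for `i = 1, …, p`, which again contradicts (∗∗)", p. 395):
for a minimal-degree datum of degree `s` over the system `h̄` at `ᾱ`, no system of more than `p`
elements of degree `< s` has `ᾱ` as a non-singular zero. [cite: Wilkie1989, Lemma 2 (proof, p. 395)] -/
theorem MinBad.card_le_of_degLT {g : ℕ → termFnRing f n} {j : ℕ} {G₀ : termFnRing f n}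
    {P : Polynomial (chain f n g j)} {s : ℕ} (h : MinBad {α} j F G₀ α P s) {q : ℕ}
    {G : Fin q → termFnRing f n} (hG : ∀ i, DegLT (chain f n g j) (chainGen f n g j) (G i) s)
    (hαG : α ∈ VnsF f n G) : q ≤ p :=
  card_le_of_forall_jrow_mem_span hαG.2 fun i =>
    jrow_mem_span_of_vct h.hβV (h.hmin (G i) α (hG i) rfl h.hβV (hαG.1 i))

end Span

/-! ### The induction of Lemma 1 up to a given stage -/

section Truncated

variable {g : ℕ → termFnRing f n} {S : Set (Fin n → K)}

/-- **A good system with the maximal number of equations among the stages `≤ J`** (the induction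
of Lemma 1 run inside `M_J`; cf. `lemma1_main`). [cite: Wilkie1989, Lemma 2 (proof, p. 395)] -/
theorem exists_goodSys_max_le (hS : S.Nonempty) (J : ℕ) :
    ∃ (p j₀ : ℕ) (F : Fin p → termFnRing f n), j₀ ≤ J ∧ GoodSys S g j₀ F ∧
      ∀ (j q : ℕ) (F' : Fin q → termFnRing f n), j ≤ J → GoodSys S g j F' → q ≤ p := by
  classical
  let Pq : ℕ → Prop := fun q => ∃ (j : ℕ) (F : Fin q → termFnRing f n), j ≤ J ∧ GoodSys S g j F
  have h0 : Pq 0 := ⟨0, Fin.elim0, Nat.zero_le J, goodSys_zero hS⟩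
  set p := Nat.findGreatest Pq n with hp
  have hPp : Pq p := Nat.findGreatest_spec (Nat.zero_le n) h0
  obtain ⟨j₀, F, hj₀, hgood⟩ := hPp
  refine ⟨p, j₀, F, hj₀, hgood, fun j q F' hj hg' => ?_⟩
  exact Nat.le_findGreatest hg'.1 ⟨j, F', hj, hg'⟩

/-- **Such a system satisfies (3) at every stage from its own up to `J`** (else the extension step
`lemma1_step` would produce a good system with more equations at a stage `≤ J`; cf.
`clause3_of_maximal`). [cite: Wilkie1989, Lemma 2 (proof, p. 395)] -/
theorem clause3_of_maximal_le (hg : ∀ i, n ≤ i → g i ∈ chain f n g i) {J j₀ p : ℕ}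
    {F : Fin p → termFnRing f n} (hgood : GoodSys S g j₀ F)
    (hmax : ∀ (j q : ℕ) (F' : Fin q → termFnRing f n), j ≤ J → GoodSys S g j F' → q ≤ p)
    (hpn : p < n) : ∀ j, j₀ ≤ j → j ≤ J → Clause3 S g j F := by
  intro j hj hjJ
  induction j with
  | zero =>
    obtain rfl : j₀ = 0 := Nat.le_zero.1 hj
    exact hgood.2.2.2.resolve_left hpn.ne
  | succ j ih =>
    rcases Nat.of_le_succ hj with hle | heq
    · have h3 := ih hle (Nat.le_of_succ_le hjJ)
      by_contra hfail
      have hF : ∀ r, F r ∈ chain f n g j := fun r => chain_mono f n g hle (hgood.2.1 r)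
      obtain ⟨G, hG, h2, h3'⟩ := lemma1_step hg hpn hF h3 hfail
      have hgood' : GoodSys S g (j + 1) (Fin.snoc F G) := by
        refine ⟨hpn, fun r => ?_, h2, Or.inr h3'⟩
        refine Fin.lastCases ?_ (fun r => ?_) r
        · simpa using hG
        · simpa using chain_le_succ f n g j (hF r)
      have := hmax (j + 1) (p + 1) _ hjJ hgood'
      omega
    · subst heq
      exact hgood.2.2.2.resolve_left hpn.ne

end Truncated

/-! ### Lemma 2, with the information from its proof -/

section Lemma2

variable {g : ℕ → termFnRing f n}

/-- **Wilkie 1989, Lemma 2, for `M = M_{J+1} = M_J[Y]` and `S = {ᾱ}`, with the proof information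
used in §6.**  There is a system `h₁, …, hₚ` of elements of `M_J` (degree `≤ 0` in `M`), `p ≤ n`,
with `ᾱ ∈ Vⁿˢ(h₁, …, hₚ)`, such that one of the following holds:
(a) `p = n`;
(b) `p < n` and clause (3) holds for `h̄` at stage `J + 1`: every element of `M` vanishing at `ᾱ`
vanishes on `V(h̄)` close to `ᾱ`;
(c) `p < n` and there is a minimal-degree datum `MinBad {ᾱ} J h̄ hₚ₊₁ ᾱ P s` (Case 2 of the proof
of Lemma 1: `hₚ₊₁ = P(Y) ∈ M` of exact degree `s ≥ 1`, vanishing at `ᾱ` but not on `V(h̄)` close to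
`ᾱ`, with `s` minimal), `ᾱ ∈ Vⁿˢ(h̄, hₚ₊₁)`, and clause (3) holds for `(h̄, hₚ₊₁)` at stage `J + 1`.
In all cases `p` (resp. `p + 1` in case (c), when `p + 1 < n`) is the maximal size of a system from
`M` having `ᾱ` as a non-singular zero (`card_le_of_clause3`, `MinBad.card_le_of_degLT`); this is
the printed Lemma 2 ((1): degrees `≤ 0, …, ≤ 0, ≤ s`; (2); (3)) together with "`hₚ'` was chosen of
minimal degree" (p. 395) as used on p. 407. [cite: Wilkie1989, Lemma 2] -/
theorem lemma2_cases (hg : ∀ i, n ≤ i → g i ∈ chain f n g i) (J : ℕ) (α : Fin n → K) :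
    ∃ (p : ℕ) (F : Fin p → termFnRing f n), p ≤ n ∧ (∀ r, F r ∈ chain f n g J) ∧
      α ∈ VnsF f n F ∧
      (p = n ∨
        (p < n ∧ Clause3 {α} g (J + 1) F) ∨
        (p < n ∧ ∃ (G : termFnRing f n) (P : Polynomial (chain f n g J)) (s : ℕ),
          MinBad {α} J F G α P s ∧ α ∈ VnsF f n (Fin.snoc F G) ∧
            Clause3 {α} g (J + 1) (Fin.snoc F G))) := by
  obtain ⟨p, j₀, F, hj₀, hgood, hmax⟩ :=
    exists_goodSys_max_le (g := g) (Set.singleton_nonempty α) J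
  obtain ⟨hpn, hF, ⟨α', hα', hαV⟩, h3⟩ := hgood
  obtain rfl : α' = α := hα'
  have hFJ : ∀ r, F r ∈ chain f n g J := fun r => chain_mono f n g hj₀ (hF r)
  refine ⟨p, F, hpn, hFJ, hαV, ?_⟩
  rcases eq_or_lt_of_le hpn with hpeq | hplt
  · exact Or.inl hpeq
  · -- clause (3) holds at stage `J`
    have h3J : Clause3 {α'} g J F :=
      clause3_of_maximal_le hg ⟨hpn, hF, ⟨α', Set.mem_singleton α', hαV⟩, h3⟩ hmax hplt J hj₀ le_rfl
    by_cases h3' : Clause3 {α'} g (J + 1) F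
    · exact Or.inr (Or.inl ⟨hplt, h3'⟩)
    · obtain ⟨G, β, P, s, hmb⟩ := MinBad.exists hplt hFJ h3J h3'
      obtain rfl : β = α' := hmb.hβS
      exact Or.inr (Or.inr ⟨hplt, G, P, s, hmb, hmb.mem_VnsF_snoc hg, hmb.clause3_snoc⟩)

/-- **The degree bound of §6** (p. 403: "By Lemma 2 (with `p = n`) there are `h₁, …, hₙ ∈ M[e^g]`
such that (1) `h₁, …, hₙ₋₁ ∈ M` and `hₙ = Σᵢ₌₀^{s+1} aᵢ e^{ig}` …, (2) `ᾱ ∈ Vⁿˢ(h₁, …, hₙ)`"): in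
case (c) of `lemma2_cases`, if some system of `p + 1` elements of `M` of degree `< s'` has `ᾱ` as a
non-singular zero then the minimal degree `s` is at most … precisely `s ≤ s' - 1`, i.e. `s < s'`.
[cite: Wilkie1989, §6, p. 403] -/
theorem MinBad.lt_of_vnsF {α : Fin n → K} {J p : ℕ} {F : Fin p → termFnRing f n}
    {G₀ : termFnRing f n} {P : Polynomial (chain f n g J)} {s : ℕ}
    (h : MinBad {α} J F G₀ α P s) {s' : ℕ} {G : Fin (p + 1) → termFnRing f n}
    (hG : ∀ i, DegLT (chain f n g J) (chainGen f n g J) (G i) s') (hαG : α ∈ VnsF f n G) :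
    s < s' := by
  by_contra hle
  rw [not_lt] at hle
  have hG' : ∀ i, DegLT (chain f n g J) (chainGen f n g J) (G i) s := by
    intro i
    obtain ⟨Q, hQ, hQG⟩ := hG i
    exact ⟨Q, lt_of_lt_of_le hQ hle, hQG⟩
  have := h.card_le_of_degLT hG' hαG
  omega

end Lemma2

end RealExpModel

end Literature.ModelTheory.ExponentialFields
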